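import Summits.ResolutionOfSingularities.ResolutionOfSingularities.Theorems.HilbertSamuelEliminationSigmaMaxModificationsCorridor3WLadderBlownUpCentre
import Summits.ResolutionOfSingularities.ResolutionOfSingularities.Theorems.HilbertSamuelEliminationSigmaMaxModificationsCorridor3WLadderMovingTwoGradeZero
import HarnessLib

/-!
# [OURS · L1 W4.2] The canonical centre at a BLOWN-UP marked point of the characteristic-2 row `stub_Wlow3M_two`:
# `dim_{x_n} C < e_{x_n}` and `C_{x_n} = 𝔪_{x_n}` when `e ≤ 1` — for ALL primes and ALL maximal origins, modulo the (F1♯)-binder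
# `Theorem314_geomDir` (crux chain w42, line `w_ladder` v5b; `--supports stmt-ResolutionOfSingularities-19249`, helper)

Stub worker res-L1-w42-stub-3 (gen 3). Stub-2's `…Corridor3WLadderBlownUpCentre` proves, in the (F1) regime `QCharRegime p` and
modulo the print-faithful binder `CossartJannsenSaito2020_thm_3_14`, that THE canonical centre through a blown-up marked point with a
next marked point above it satisfies `dim (𝒪_{X_n,x_n}/C_{x_n}) < e_{x_n}(X_n)`, hence `C_{x_n} = 𝔪_{x_n}` when `e ≤ 1` — the entry
point of the grade-1 / third-door argument (CJS Cor. 6.37: point blow-ups) and of Def. 6.38 (ii). The regime is used ONLY to produce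
`CharHypothesis` at `x_n`. This file is the (F1♯) twin for the characteristic-2 row: with the binder `Theorem314_geomDir`
(`…MovingTwoDefs`: `Theorem314_dim_lt_dirDim` with `CharHypothesis` ↦ `GeomDirHypothesis`, the numerical shadow of the directrix
theorem 2.14♯) and `GeomDirHypothesis` AUTOMATIC at `ē ≤ 2` (`geomDirHypothesis_of_geomDirDim_le_two`), the same conclusions hold
at every blown-up marked point of a W-low chain from ANY maximal origin, any prime:

* `centreDim_lt_dirDim_of_isBlownUp_geomDir` — good stage, marked point in the `ν`-stratum with `GeomDirHypothesis`, canonical near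
  step out of it, centre `C ∋ x_n` ⇒ `dim (𝒪_{X_n,x_n}/C_{x_n}) < e_{x_n}`;
* `stalkIdeal_centre_eq_maximalIdeal_of_dirDim_le_one_geomDir` — `+ e ≤ 1` ⇒ `C_{x_n} = 𝔪_{x_n}`;
* `stalkIdeal_centre_eq_maximalIdeal_of_reaches_geomDir` — packaged along `Reaches` from ANY maximal origin at level `3`
  (`ν ≠ Φ^{(3)}`) for marked points with `e ≤ 1` and `ē ≤ 2`: locally at the marked point the genuine step is the blow-up of the closed
  point — so stub-2's local point-blow-up data (`…Corridor3WLadderLocalPointBlowup`, fact-free) applies verbatim to the char-2 row.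
  (At an ISOLATED blown-up stage no binder is needed at all: stub-1's fact-free `IsMaximalOrigin.stalkIdeal_centre_eq_maximalIdeal_of_iso`,
  `…Corridor3IsolatedCentre`; the unit starts `e = ē = 2` of the char-2 row use that lemma.)

OURS (cell res-hironaka, slot W4.2); NOT statements of the manuscript [Hironaka2017] nor of [CossartJannsenSaito2020];
AI-drafted, weaker than expert review. References: CJS LNM 2270 Def. 3.1, Thm. 3.14, Lemma 3.15, Def. 6.34, Cor. 6.37, Def. 6.38 (ii)
[CossartJannsenSaito2020]; H. Mizutani, Nagoya Math. J. 52 (1973) Thm. 2.8 [Mizutani1973HironakaGroupSchemes]; stub-2's BlownUpCentre.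
-/

noncomputable section

-- namespace `…Corridor3.Moving` re-enters `…Corridor3` (module convention of the Moving files)
set_option linter.dupNamespace false

open CategoryTheory AlgebraicGeometry TopologicalSpace IsLocalRing
open Literature.AlgebraicGeometry.Resolution Literature.RingTheory.HilbertSamuel

universe u

open Summit.ResolutionOfSingularities.ResolutionOfSingularities.Theorems.CampaignW42
open Literature.AlgebraicGeometry.CossartJannsenSaito2020
open Summit.ResolutionOfSingularities.ResolutionOfSingularities.Theorems.SigmaMaxModificationsCorridor3

namespace Summit.ResolutionOfSingularities.ResolutionOfSingularities.Theorems.SigmaMaxModificationsCorridor3.Moving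

variable {R : ∀ S : Scheme.{u}, CentreSeq S → Prop} {N : ℕ} {ν : ℕ → ℕ}

/-- **`dim_{x_n} C < e_{x_n}(X_n)` for THE canonical centre through a blown-up marked point, (F1♯) form** (modulo
`Theorem314_geomDir`): stub-2's `centreDim_lt_dirDim_of_isBlownUp` with `CharHypothesis` replaced by `GeomDirHypothesis`.
[cite: CossartJannsenSaito2020, Thm. 3.14] -/
theorem centreDim_lt_dirDim_of_isBlownUp_geomDir (hF : Theorem314_geomDir.{u}) (hRf : OracleFunctional R)
    {k : Type u} [Field k] {s s' : MarkedStage.{u}} (hg : StateGood k R N ν s.W s.L s.P)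
    (hpt : s.pt ∈ Scheme.hsStratum s.W N ν) (hst : CanonicalNearStep R N ν s s') (hgeo : @GeomDirHypothesis s.W s.ln s.pt)
    {C : s.W.IdealSheafData} {P' : Option (Pending (blowup C))} (hcs : IsCanonicalStep R N ν s.L s.P C P')
    (hmem : s.pt ∈ (C.support : Set s.W)) :
    ringKrullDim (s.W.presheaf.stalk s.pt ⧸ stalkIdeal C s.pt) < (dirDim s : WithBot ℕ∞) := by
  haveI : IsLocallyNoetherian s.W := s.ln
  obtain ⟨C₂, P₂', hln, x', hcs₂, hπ, -, hx', -⟩ := hst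
  obtain rfl : C = C₂ := IsCanonicalStep.centre_unique hRf hcs hcs₂
  haveI : IsLocallyNoetherian (blowup C) := hln
  have hnear : Scheme.hsFun (blowup C) N x' = Scheme.hsFun s.W N s.pt := by
    rw [Scheme.mem_hsStratum_iff.mp hx', Scheme.mem_hsStratum_iff.mp hpt]
  exact hF s.W (blowup C) (blowup.π C) C N x' s.pt hg.isExcellent (hg.isPermissible hcs₂) (blowup.isBlowup C)
    hg.dim_le hπ hmem hgeo hnear

/-- **`C_{x_n} = 𝔪_{x_n}` when `e_{x_n} ≤ 1`, (F1♯) form**: locally at the marked point the genuine step is the blow-up of the closed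
point (`𝒪_{X_n,x_n}/C_{x_n}` is a regular local ring of dimension `0`). [cite: CossartJannsenSaito2020, Thm. 3.14, Cor. 6.37, Def. 6.38 (ii)] -/
theorem stalkIdeal_centre_eq_maximalIdeal_of_dirDim_le_one_geomDir (hF : Theorem314_geomDir.{u})
    (hRf : OracleFunctional R) {k : Type u} [Field k] {s s' : MarkedStage.{u}} (hg : StateGood k R N ν s.W s.L s.P)
    (hpt : s.pt ∈ Scheme.hsStratum s.W N ν) (hst : CanonicalNearStep R N ν s s') (hgeo : @GeomDirHypothesis s.W s.ln s.pt)
    (he : dirDim s ≤ 1) {C : s.W.IdealSheafData} {P' : Option (Pending (blowup C))}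
    (hcs : IsCanonicalStep R N ν s.L s.P C P') (hmem : s.pt ∈ (C.support : Set s.W)) :
    stalkIdeal C s.pt = maximalIdeal (s.W.presheaf.stalk s.pt) := by
  haveI : IsLocallyNoetherian s.W := s.ln
  have hlt := centreDim_lt_dirDim_of_isBlownUp_geomDir hF hRf hg hpt hst hgeo hcs hmem
  have hperm : (stalkIdeal C s.pt).IsPermissible := hg.isPermissible hcs s.pt hmem
  refine Ideal.eq_maximalIdeal_of_isRegularLocalRing_quotient_of_ringKrullDim_lt_one hperm.isRegularLocalRing ?_
  exact hlt.trans_le (by exact_mod_cast he)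

/-- **Along a chain from ANY maximal origin (any prime, any regime; `ν ≠ Φ^{(3)}`): at a blown-up stage with `e ≤ 1` and `ē ≤ 2`
that has a next marked point, THE canonical centre is the maximal ideal at the marked point** (good states from
`stateGood_init_general`; (F1♯) automatic from `ē ≤ 2`). The char-2 twin of stub-2's `stalkIdeal_centre_eq_maximalIdeal_of_reaches`.
[cite: CossartJannsenSaito2020, Thm. 3.14, Cor. 6.37] -/
theorem stalkIdeal_centre_eq_maximalIdeal_of_reaches_geomDir (hF : Theorem314_geomDir.{u})
    (hRf : OracleFunctional R) (hRa : OracleAdmissible R) {p : ℕ} {X : Scheme.{u}} [IsLocallyNoetherian X] {x : X}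
    (hX : IsMaximalOrigin p 3 ν X x) (hν : ν ≠ iterPSum 3 Phi)
    {s s' : MarkedStage.{u}} (hreach : Reaches R 3 ν (MarkedStage.init X x) s) (hst : CanonicalNearStep R 3 ν s s')
    (he : dirDim s ≤ 1) (hē : s.geomDirDim ≤ 2) {C : s.W.IdealSheafData} {P' : Option (Pending (blowup C))}
    (hcs : IsCanonicalStep R 3 ν s.L s.P C P') (hmem : s.pt ∈ (C.support : Set s.W)) :
    stalkIdeal C s.pt = maximalIdeal (s.W.presheaf.stalk s.pt) := by
  obtain ⟨k, _, _, f, -, hft, hqc⟩ := hX.exists_structure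
  haveI := hft
  haveI := hqc
  haveI := hX.isReduced
  have hgood : StateGood k R 3 ν s.W s.L s.P :=
    stateGood_of_reaches (stateGood_init_general hRa f hX.dim_le hX.maximal hν) hreach
  exact stalkIdeal_centre_eq_maximalIdeal_of_dirDim_le_one_geomDir hF hRf hgood
    (pt_mem_hsStratum_of_reaches hX.mem_stratum hreach) hst
    (@geomDirHypothesis_of_geomDirDim_le_two s.W s.ln s.pt hē) he hcs hmem

end Summit.ResolutionOfSingularities.ResolutionOfSingularities.Theorems.SigmaMaxModificationsCorridor3.Moving

end
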